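/-
Copyright (c) 2026 the pub-hodgecm-mathlib formalisation cell (harness21).  Prover seat hodgecm-mathlib-K2Liu-p14 (g3), Track B «K2-LIT»,
#184♮ = hLiu418 = `stmt-HodgeConjecture-24832`; Road I v3, S5-F3 lineage ∕ I4-conv (F′-fact), FILE E part 1: the natural-coordinate SHAPE of the Klingen-fibre integrand.
-/
import Summits.HodgeConjecture.HodgeConjecture.Theorems.K2LiuKlingenInnerSectionLocalTransport   -- ★ FILE B2 (+ ★ FILE B: letters, `psiLoc`, `evalPlace_finPart_letters`, `innerSectionLoc`)
import Summits.HodgeConjecture.HodgeConjecture.Theorems.K2LiuKlingenInnerSectionLocalInvariance  -- ★ `hK` payer: `klingenLeviLoc_one_mem_localInt`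
import Summits.HodgeConjecture.HodgeConjecture.Theorems.K2LiuKlingenUnipotentDefs               -- ★ `nKlingen_inv`
import Literature.NumberTheory.Automorphic.AdicCompletionIntegerSpellings                      -- ★ `mem_valuationInteger_iff_mem_valuedInteger`
import Literature.NumberTheory.K2Lit.LocalDoublingUnramifiedHecke                              -- ★ #31s: `LambdaLoc`, `IsFactorizableOff` (the shape of `f` off `T′`)
import Literature.NumberTheory.Automorphic.GaloisActionAdeleRing                               -- ★ `AdeleRing.smul_fst` (the conjugation is a product map)
import HarnessLib

/-!
# Crux `HLiu418`, I4-conv (F′-fact), FILE E part 1 — `K2LiuKlingenInnerSectionShape`: THE INTEGRAND OF THE INNER SECTION OF TERM 2 IN THE NATURAL FIBRE COORDINATES —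
# `f(Ψ(ξ)·Ψ(n_Q(y,0,t))·(Ψ(m_Q(1,j₂⁻¹g₂))·h)) = f_{T′}(∞-part(y_∞,t_∞), (T′-parts)) · ∏ᶠ_{v∉T′} Λ^{(2)}_{s,v}(Ψ_v(ξ_v n_{Q,v}(y_v,0,t_v) m_{Q,v}(1,(g₂)_v)) · h_v)`

Cell `hodgecm-mathlib`, crux item hLiu418 = `stmt-HodgeConjecture-24832`; squad K2 ∕ K2Liu; LEAD F0P6-plan (g14) BATCH #36 (E = mine); prover K2Liu-p14 (g3); E split with
F0P2-p09 (g0) (E-D0: the natural-coordinate corollary of ★ D0∘D) ∕ me (E-grp: this file + the assembly).  THEOREMS ONLY (no `def`, no instance, no notation, no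
named-fact hypothesis, no `sorry`); lane `--supports stmt-HodgeConjecture-24832 --as helper` (count-neutral).

WHAT.  For a section `f : H(𝔸) → ℂ` of FACTORIZABLE SHAPE off `T′` (★ #31s `IsFactorizableOff` at a fixed parameter: `hfT`), a transport `Ψ : U(J₄)(𝔸) ≃ₜ* H(𝔸)` pinned as
conjugation by `S_𝔸` (the F-files' `hΨ`), `h ∈ H(𝔸)`, `g₂ ∈ U(J₂)(𝔸)`, the integrand `q = (y, t) ↦ f(Ψ(ξ)·Ψ(n_Q(y,0,t))·(Ψ(m_Q(1, j₂⁻¹ g₂))·h))` of ★ F8's inner section `F′_h(g₂)`: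
* §1 (archimedean letters) `archPart_eq_of_map_fst_eq` (the archimedean component of `g ∈ U(J)(𝔸)` is read off the infinite parts of its entries), `nKlingenM_map_fst`
  (★ B's generic `nKlingenM_map` at `fst : 𝔸_L → L_∞`, the involution being a product map: ★ `AdeleRing.smul_fst`), **`archPart_jAdelic_nKlingen_eq_of_fst_eq`**
  (`(n_Q(y,z,t))_∞` depends only on `(y_∞, z_∞, t_∞)`), **`archPart_arg_eq_of_fst_eq`** (hence so does `(Ψ(ξ)·Ψ(n_Q(y,0,t))·(Ψ(m_Q(1,j₂⁻¹g₂))·h))_∞`, ★ B2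
  `archPart_eq_archPart_archToAdelic`);
* §2 (finite places) **`evalPlace_finPart_arg`** (★ B `evalPlace_finPart_letters`, rewritten with `psiLoc Ψ v`);
* §3 **`integrand_eq_mul_finprod`** — THE SHAPE: `f(…) = fT (…_∞, (…_v)_{v∈T′}) · ∏ᶠ_{v∉T′} Λ_{s,v}(psiLoc Ψ v (ξ_v · n_{Q,v}(y_v, 0, t_v) · m_{Q,v}(1,(g₂)_v)) · h_v)` — the local factor
  being LITERALLY the integrand of ★ B's `innerSectionLoc v νY νT (psiLoc Ψ v) (LambdaLoc … v χ s) h_v (g₂)_v` at `q_v = (⟨y_v, _⟩, t_v)` (`integrand_local_factor_eq`), and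
  `integrand_local_factor_eq_one` — it equals `1` whenever `y_v, t_v` are integral, `(g₂)_v ∈ U(J₂)(𝒪_v)`, `h_v ∈ K_{H,v}`, `Ψ_v(U(J₄)(𝒪_v)) ≤ K_{H,v}` and `χ` is unramified
  above `v` (★ `lambdaLoc_of_mem_localInt`, ★ `klingenLeviLoc_one_mem_localInt`, `nKlingenLoc_mem_localInt`, `weylXiLoc_mem_localInt`) — Tate's normalisation off the finite
  `y`-dependent exceptional set of ★ FILE D part 2.
[BorelJacquet1979, §4.1], [MoeglinWaldspurger1995, II.1.7], [Liu2011, §2B p. 862], [Xiong2013, §7 Lemma 7.1].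
HONEST LABEL.  Count-neutral helper, closes no socket: `HC_CM` is proved only modulo the 7 printed citations (2 remaining named inputs: hLiu418 =
`stmt-HodgeConjecture-24832`, h413 = `stmt-HodgeConjecture-24833`) until rung 0 closes.
-/

set_option autoImplicit false
set_option linter.dupNamespace false -- the mandated namespace repeats `HodgeConjecture.HodgeConjecture`

noncomputable section

open scoped Matrix
open NumberField IsDedekindDomain

namespace Summit.HodgeConjecture.HodgeConjecture.Cruxes.HLiu418.K2LiuKlingenInnerSectionShape

open Literature.NumberTheory.Automorphic Literature.NumberTheory.Automorphic.UnitaryGroup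
open Literature.NumberTheory.GelbartRogawski1991 Literature.NumberTheory.GelbartRogawski1991.GRConstruction
open Literature.NumberTheory.GaloisRepresentations
open Literature.NumberTheory.K2Lit.SiegelDoubled
open Summit.HodgeConjecture.HodgeConjecture.Cruxes.HLiu418.K2LiuKlingenParabolicDefs
open Summit.HodgeConjecture.HodgeConjecture.Cruxes.HLiu418.K2LiuKlingenUnipotentDefs (nKlingen_inv)
open Summit.HodgeConjecture.HodgeConjecture.Cruxes.HLiu418.K2LiuKlingenUnipotentAdelicDefs
open Summit.HodgeConjecture.HodgeConjecture.Cruxes.HLiu418.K2LiuSiegelDoubledLeviMatrix (conjAdele_conjAdele')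
open Summit.HodgeConjecture.HodgeConjecture.Cruxes.HLiu418.K2LiuKlingenInnerSectionLocalDefs
open Summit.HodgeConjecture.HodgeConjecture.Cruxes.HLiu418.K2LiuKlingenInnerSectionLocalTransport

variable (L : Type) [Field L] [NumberField L] [IsCMField L]

/-! ## §1 Archimedean letters: `(n_Q(y,z,t))_∞` depends only on `(y_∞, z_∞, t_∞)` -/

/-- the archimedean component of `g ∈ U(J)(𝔸)` is read off the infinite parts of its entries (★ `coe_archPart`: `g_∞ = toMixed(g) = infiniteEquivMixed(fst g)`).
[cite: BorelJacquet1979, §4.1] -/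
theorem archPart_eq_of_map_fst_eq {N : ℕ} {J : Matrix (Fin N) (Fin N) L} (g g' : (adelicGroupData (Fp L) L (IsCMField.complexConj L) N J).Adelic)
    (h : ((g.1 : GL (Fin N) (AdeleRing (𝓞 L) L)) : Matrix (Fin N) (Fin N) (AdeleRing (𝓞 L) L)).map Prod.fst =
      ((g'.1 : GL (Fin N) (AdeleRing (𝓞 L) L)) : Matrix (Fin N) (Fin N) (AdeleRing (𝓞 L) L)).map Prod.fst) :
    UnitaryGroup.archPart (Fp L) L (IsCMField.complexConj L) N J g = UnitaryGroup.archPart (Fp L) L (IsCMField.complexConj L) N J g' := by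
  have hfst : GLn.fstHom N L g.1 = GLn.fstHom N L g'.1 := Units.ext h
  refine Subtype.ext ?_
  rw [UnitaryGroup.coe_archPart, UnitaryGroup.coe_archPart, adelicVal_apply, adelicVal_apply, GLn.toMixed_apply, GLn.toMixed_apply, hfst]

omit [IsCMField L] in
/-- the adelic matrix `n_Q(y,z,t)` read in `L_∞`: `(n_Q(y,z,t)).map fst = n_Q(y_∞, z_∞, t_∞)` for the involution `c ⊗ 1` of `L_∞` (★ `AdeleRing.smul_fst`: `c ⊗ 1` on `𝔸_L` is a
product map). [cite: CasselsFrohlichANT1967, Ch. II §14] [cite: Xiong2013, §7 Lemma 7.1] -/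
theorem nKlingenM_map_fst [IsCMField L] (y z t : AdeleRing (𝓞 L) L) :
    (nKlingenM (AdeleRing (𝓞 L) L) (conjAdele (Fp L) L (IsCMField.complexConj L)) y z t).map Prod.fst =
      nKlingenM (InfiniteAdeleRing L) (MulSemiringAction.toRingHom (L ≃ₐ[Fp L] L) (InfiniteAdeleRing L) (IsCMField.complexConj L)) y.1 z.1 t.1 :=
  nKlingenM_map _ _ (RingHom.fst (InfiniteAdeleRing L) (FiniteAdeleRing (𝓞 L) L))
    (fun x => by
      show (conjAdele (Fp L) L (IsCMField.complexConj L) x).1 = IsCMField.complexConj L • x.1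
      rw [conjAdele_apply, AdeleRing.smul_fst]) y z t

/-- **`(n_Q(y,z,t))_∞` depends only on `(y_∞, z_∞, t_∞)`.** [cite: BorelJacquet1979, §4.1] [cite: Xiong2013, §7 Lemma 7.1] -/
theorem archPart_jAdelic_nKlingen_eq_of_fst_eq {y y' : AdeleRing (𝓞 L) L} (hy : conjAdele (Fp L) L (IsCMField.complexConj L) y = -y)
    (hy' : conjAdele (Fp L) L (IsCMField.complexConj L) y' = -y') {z z' t t' : AdeleRing (𝓞 L) L} (h1 : y.1 = y'.1) (h2 : z.1 = z'.1) (h3 : t.1 = t'.1) :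
    UnitaryGroup.archPart (Fp L) L (IsCMField.complexConj L) 4 ((StdForm.antidiagonal 4).over L)
        (jAdelic L 4 (nKlingen (AdeleRing (𝓞 L) L) (conjAdele (Fp L) L (IsCMField.complexConj L)) (conjAdele_conjAdele' L) y hy z t)) =
      UnitaryGroup.archPart (Fp L) L (IsCMField.complexConj L) 4 ((StdForm.antidiagonal 4).over L)
        (jAdelic L 4 (nKlingen (AdeleRing (𝓞 L) L) (conjAdele (Fp L) L (IsCMField.complexConj L)) (conjAdele_conjAdele' L) y' hy' z' t')) := by
  refine archPart_eq_of_map_fst_eq L _ _ ?_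
  have e1 : (((jAdelic L 4 (nKlingen (AdeleRing (𝓞 L) L) (conjAdele (Fp L) L (IsCMField.complexConj L)) (conjAdele_conjAdele' L) y hy z t)).1 :
      GL (Fin 4) (AdeleRing (𝓞 L) L)) : Matrix (Fin 4) (Fin 4) (AdeleRing (𝓞 L) L)) = nKlingenM (AdeleRing (𝓞 L) L) (conjAdele (Fp L) L (IsCMField.complexConj L)) y z t := by
    rw [← adelicVal_apply, coe_adelicVal_jAdelic, coe_nKlingen]
  have e2 : (((jAdelic L 4 (nKlingen (AdeleRing (𝓞 L) L) (conjAdele (Fp L) L (IsCMField.complexConj L)) (conjAdele_conjAdele' L) y' hy' z' t')).1 :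
      GL (Fin 4) (AdeleRing (𝓞 L) L)) : Matrix (Fin 4) (Fin 4) (AdeleRing (𝓞 L) L)) = nKlingenM (AdeleRing (𝓞 L) L) (conjAdele (Fp L) L (IsCMField.complexConj L)) y' z' t' := by
    rw [← adelicVal_apply, coe_adelicVal_jAdelic, coe_nKlingen]
  rw [e1, e2, nKlingenM_map_fst, nKlingenM_map_fst, h1, h2, h3]

/-- **the archimedean component of the term-2 argument depends only on `(y_∞, t_∞)`** (given `Ψ` pinned, `h`, `g₂`): ★ B2 `archPart_eq_archPart_archToAdelic` + §1.
[cite: BorelJacquet1979, §4.1] [cite: MoeglinWaldspurger1995, II.1.7] -/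
theorem archPart_arg_eq_of_fst_eq {J' : Matrix (Fin 4) (Fin 4) L}
    (Ψ : (adelicGroupData (Fp L) L (IsCMField.complexConj L) 4 ((StdForm.antidiagonal 4).over L)).Adelic →* (adelicGroupData (Fp L) L (IsCMField.complexConj L) 4 J').Adelic)
    (SA : GL (Fin 4) (AdeleRing (𝓞 L) L))
    (hΨ : ∀ g : (adelicGroupData (Fp L) L (IsCMField.complexConj L) 4 ((StdForm.antidiagonal 4).over L)).Adelic,
      (((Ψ g).1 : GL (Fin 4) (AdeleRing (𝓞 L) L)) : Matrix (Fin 4) (Fin 4) (AdeleRing (𝓞 L) L)) =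
        (SA : Matrix (Fin 4) (Fin 4) (AdeleRing (𝓞 L) L)) *
          ((adelicVal (Fp L) L (IsCMField.complexConj L) 4 ((StdForm.antidiagonal 4).over L) g : GL (Fin 4) (AdeleRing (𝓞 L) L)) :
            Matrix (Fin 4) (Fin 4) (AdeleRing (𝓞 L) L)) *
          ((SA⁻¹ : GL (Fin 4) (AdeleRing (𝓞 L) L)) : Matrix (Fin 4) (Fin 4) (AdeleRing (𝓞 L) L)))
    {y y' : AdeleRing (𝓞 L) L} (hy : conjAdele (Fp L) L (IsCMField.complexConj L) y = -y) (hy' : conjAdele (Fp L) L (IsCMField.complexConj L) y' = -y')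
    {t t' : AdeleRing (𝓞 L) L} (h1 : y.1 = y'.1) (h3 : t.1 = t'.1)
    (a b : (adelicGroupData (Fp L) L (IsCMField.complexConj L) 4 J').Adelic) :
    UnitaryGroup.archPart (Fp L) L (IsCMField.complexConj L) 4 J'
        (a * Ψ (jAdelic L 4 (nKlingen (AdeleRing (𝓞 L) L) (conjAdele (Fp L) L (IsCMField.complexConj L)) (conjAdele_conjAdele' L) y hy 0 t)) * b) =
      UnitaryGroup.archPart (Fp L) L (IsCMField.complexConj L) 4 J'
        (a * Ψ (jAdelic L 4 (nKlingen (AdeleRing (𝓞 L) L) (conjAdele (Fp L) L (IsCMField.complexConj L)) (conjAdele_conjAdele' L) y' hy' 0 t')) * b) := by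
  rw [map_mul, map_mul, map_mul, map_mul, archPart_eq_archPart_archToAdelic L Ψ SA hΨ (jAdelic L 4 (nKlingen _ _ _ y hy 0 t)),
    archPart_eq_archPart_archToAdelic L Ψ SA hΨ (jAdelic L 4 (nKlingen _ _ _ y' hy' 0 t')), archPart_jAdelic_nKlingen_eq_of_fst_eq L hy hy' h1 rfl h3]

/-! ## §2 Integrality of the local letters `ξ_v`, `n_{Q,v}(y, 0, t)` -/

omit [IsCMField L] in
/-- the entries of `n_Q(y,z,t)` lie in every `σ`-stable subring containing `y, z, t`. [cite: Xiong2013, §7 Lemma 7.1] -/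
theorem nKlingenM_apply_mem {R : Type*} [CommRing R] (σ : R →+* R) (S : Subring R) (hσS : ∀ x ∈ S, σ x ∈ S) {y z t : R}
    (hy : y ∈ S) (hz : z ∈ S) (ht : t ∈ S) (i j : Fin 4) : nKlingenM R σ y z t i j ∈ S := by
  have h1 := hσS _ hz
  have h2 := hσS _ ht
  fin_cases i <;> fin_cases j <;> simp [nKlingenM, S.one_mem, S.zero_mem, hy, hz, ht, h1, h2, S.sub_mem, S.mul_mem, S.neg_mem]

omit [IsCMField L] in
/-- the entries of `ξ` and of `ξ⁻¹` are `0` or `1`. [cite: Xiong2013, §7 Lemma 7.1] -/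
theorem weylXi_apply_mem {R : Type*} [CommRing R] (σ : R →+* R) (S : Subring R) (i j : Fin 4) :
    (((weylXi R σ : unitaryGroupOfForm σ ((StdForm.antidiagonal 4).over R)) : GL (Fin 4) R) : Matrix (Fin 4) (Fin 4) R) i j ∈ S ∧
      ((((weylXi R σ)⁻¹ : unitaryGroupOfForm σ ((StdForm.antidiagonal 4).over R)) : GL (Fin 4) R) : Matrix (Fin 4) (Fin 4) R) i j ∈ S := by
  rw [coe_weylXi, coe_weylXi_inv]
  fin_cases i <;> fin_cases j <;> simp [weylXiM, S.one_mem, S.zero_mem]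

/-- the subring of `L_v` of elements integral at EVERY place above `v`; it is stable under `c ⊗ 1` (★ `valued_galAdicCompletionMap`: `σ` permutes the places above `v`
and preserves the valuations). [cite: CasselsFrohlichANT1967, Ch. VII §1.1] -/
theorem conjLocal_mem_iInf_integer (v : HeightOneSpectrum (𝓞 (Fp L))) {x : LocalRing L v}
    (hx : x ∈ ⨅ w : UnitaryGroup.PlacesOver L v, ((ValuativeRel.valuation (w.1.adicCompletion L)).integer).comap
      (Pi.evalRingHom (fun w : UnitaryGroup.PlacesOver L v => w.1.adicCompletion L) w)) :
    conjLocal L (IsCMField.complexConj L) v x ∈ ⨅ w : UnitaryGroup.PlacesOver L v, ((ValuativeRel.valuation (w.1.adicCompletion L)).integer).comap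
      (Pi.evalRingHom (fun w : UnitaryGroup.PlacesOver L v => w.1.adicCompletion L) w) := by
  rw [Subring.mem_iInf] at hx ⊢
  intro w
  have h := hx ⟨(IsCMField.complexConj L)⁻¹ • w.1, under_inv_smul_eq (IsCMField.complexConj L) w⟩
  rw [Subring.mem_comap, Pi.evalRingHom_apply, mem_valuationInteger_iff_mem_valuedInteger, Valuation.mem_integer_iff] at h ⊢
  rw [conjLocal_apply, valued_galAdicCompletionMap]
  exact h

set_option maxHeartbeats 400000 in -- MEASURED: generic-ring §2 lemmas instantiated at `LocalRing L v` (instance-path unification, as ★ FILE B)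
/-- **`n_{Q,v}(y, 0, t) ∈ U(J₄)(𝒪_v)` when `y` and `t` are integral at every place above `v`** (entries of `n_Q` and of `n_Q⁻¹ = n_Q(−y + …, 0, −t)` ★ `nKlingen_inv`).
[cite: PlatonovRapinchuk1994, §5.1] [cite: Xiong2013, §7 Lemma 7.1] -/
theorem nKlingenLoc_mem_localInt (v : HeightOneSpectrum (𝓞 (Fp L))) {y : LocalRing L v} (hys : conjLocal L (IsCMField.complexConj L) v y = -y) {t : LocalRing L v}
    (hy : ∀ w : UnitaryGroup.PlacesOver L v, y w ∈ (ValuativeRel.valuation (w.1.adicCompletion L)).integer)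
    (ht : ∀ w : UnitaryGroup.PlacesOver L v, t w ∈ (ValuativeRel.valuation (w.1.adicCompletion L)).integer) :
    nKlingenLoc L v y hys 0 t ∈ UnitaryGroup.localInt L (IsCMField.complexConj L) 4 ((StdForm.antidiagonal 4).over L) v := by
  set S : Subring (LocalRing L v) := ⨅ w : UnitaryGroup.PlacesOver L v, ((ValuativeRel.valuation (w.1.adicCompletion L)).integer).comap
      (Pi.evalRingHom (fun w : UnitaryGroup.PlacesOver L v => w.1.adicCompletion L) w) with hSdef
  have hσS : ∀ x ∈ S, conjLocal L (IsCMField.complexConj L) v x ∈ S := fun x hx => conjLocal_mem_iInf_integer L v hx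
  have hyS : y ∈ S := Subring.mem_iInf.2 fun w => by rw [Subring.mem_comap]; exact hy w
  have htS : t ∈ S := Subring.mem_iInf.2 fun w => by rw [Subring.mem_comap]; exact ht w
  have hSw : ∀ {x : LocalRing L v}, x ∈ S → ∀ w : UnitaryGroup.PlacesOver L v, x w ∈ (ValuativeRel.valuation (w.1.adicCompletion L)).integer :=
    fun hx w => by have h := Subring.mem_iInf.1 hx w; rwa [Subring.mem_comap] at h
  rw [UnitaryGroup.mem_localInt_iff]
  intro w
  refine (mem_glInt_iff _).2 ⟨fun i j => ?_, fun i j => ?_⟩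
  · rw [nKlingenLoc, coe_jLoc_apply, coe_nKlingen]
    exact hSw (nKlingenM_apply_mem (conjLocal L (IsCMField.complexConj L) v) S hσS hyS S.zero_mem htS i j) w
  · have hinv := nKlingen_inv (R := LocalRing L v) (σ := conjLocal L (IsCMField.complexConj L) v) (conjLocal_conjLocal_cm L v) y hys 0 t
    rw [← Pi.inv_apply, ← Subgroup.coe_inv, nKlingenLoc, ← map_inv (jLoc L 4 v), hinv, coe_jLoc_apply, coe_nKlingen]
    refine hSw (nKlingenM_apply_mem (conjLocal L (IsCMField.complexConj L) v) S hσS ?_ (S.neg_mem S.zero_mem) (S.neg_mem htS) i j) w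
    exact S.add_mem (S.neg_mem hyS) (S.sub_mem (S.mul_mem S.zero_mem (hσS _ htS)) (S.mul_mem htS (hσS _ S.zero_mem)))

set_option maxHeartbeats 400000 in -- MEASURED: as above
/-- **`ξ_v ∈ U(J₄)(𝒪_v)`** (a permutation matrix). [cite: PlatonovRapinchuk1994, §5.1] [cite: Xiong2013, §7 Lemma 7.1] -/
theorem weylXiLoc_mem_localInt (v : HeightOneSpectrum (𝓞 (Fp L))) :
    weylXiLoc L v ∈ UnitaryGroup.localInt L (IsCMField.complexConj L) 4 ((StdForm.antidiagonal 4).over L) v := by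
  rw [UnitaryGroup.mem_localInt_iff]
  intro w
  refine (mem_glInt_iff _).2 ⟨fun i j => ?_, fun i j => ?_⟩
  · have h := (weylXi_apply_mem (R := LocalRing L v) (conjLocal L (IsCMField.complexConj L) v)
      (((ValuativeRel.valuation (w.1.adicCompletion L)).integer).comap (Pi.evalRingHom (fun w : UnitaryGroup.PlacesOver L v => w.1.adicCompletion L) w)) i j).1
    rw [Subring.mem_comap, Pi.evalRingHom_apply] at h
    rw [weylXiLoc, coe_jLoc_apply]
    exact h
  · have h := (weylXi_apply_mem (R := LocalRing L v) (conjLocal L (IsCMField.complexConj L) v)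
      (((ValuativeRel.valuation (w.1.adicCompletion L)).integer).comap (Pi.evalRingHom (fun w : UnitaryGroup.PlacesOver L v => w.1.adicCompletion L) w)) i j).2
    rw [Subring.mem_comap, Pi.evalRingHom_apply] at h
    rw [← Pi.inv_apply, ← Subgroup.coe_inv, weylXiLoc, ← map_inv (jLoc L 4 v), coe_jLoc_apply]
    exact h

/-! ## §3 The shape of the term-2 integrand in the natural fibre coordinates -/

section Shape

variable {N M : ℕ} {e : Fin N × Fin M ≃ Fin 2}
  {dV : Fin N → L} {hdV : ∀ i, IsCMField.complexConj L (dV i) = dV i}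
  {dW : Fin M → L} {hdW : ∀ i, IsCMField.complexConj L (dW i) = dW i}
  {SA : GL (Fin (2 + 2)) (AdeleRing (𝓞 L) L)}
  {Ψ : (quasiSplit (Fp L) L (IsCMField.complexConj L) (2 + 2)).Adelic ≃ₜ* HA L e dV hdV dW hdW}
  (hΨ : ∀ g : (quasiSplit (Fp L) L (IsCMField.complexConj L) (2 + 2)).Adelic,
    (((Ψ g : HA L e dV hdV dW hdW) : GL (Fin (2 + 2)) (AdeleRing (𝓞 L) L)) : Matrix (Fin (2 + 2)) (Fin (2 + 2)) (AdeleRing (𝓞 L) L)) =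
      (SA : Matrix (Fin (2 + 2)) (Fin (2 + 2)) (AdeleRing (𝓞 L) L)) *
        ((adelicVal (Fp L) L (IsCMField.complexConj L) (2 + 2) _ g : GL (Fin (2 + 2)) (AdeleRing (𝓞 L) L)) :
          Matrix (Fin (2 + 2)) (Fin (2 + 2)) (AdeleRing (𝓞 L) L)) *
        ((SA⁻¹ : GL (Fin (2 + 2)) (AdeleRing (𝓞 L) L)) : Matrix (Fin (2 + 2)) (Fin (2 + 2)) (AdeleRing (𝓞 L) L)))

set_option maxHeartbeats 400000 in
include hΨ in
/-- **THE SHAPE OF THE TERM-2 INTEGRAND** for a family `f` ★ #31s-factorizable off `T′`: for every `q = (y, t)`,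
`f_s(Ψ(ξ)·Ψ(n_Q(y,0,t))·(Ψ(m_Q(1,j₂⁻¹g₂))·h)) = fT_s((·)_∞, ((·)_v)_{v∈T′}) · ∏ᶠ_{v∉T′} Λ_{s,v}(Ψ_v(ξ_v · n_{Q,v}(y_v, 0_v, t_v) · m_{Q,v}(1,(g₂)_v)) · h_v)` — the local factor is the
integrand of ★ B's `innerSectionLoc v … (psiLoc Ψ v) (LambdaLoc … v χ s) h_v (g₂)_v` at `(y_v, t_v)` (★ B `evalPlace_finPart_letters`; `psiLoc` at `Ψ.toMulEquiv.toMonoidHom`).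
[cite: Liu2011, §2B p. 862] [cite: BorelJacquet1979, §4.1] [cite: MoeglinWaldspurger1995, II.1.7] -/
theorem integrand_eq_mul_finprod (T' : Finset (HeightOneSpectrum (𝓞 (Fp L)))) (χ : HeckeCharacter L) (f : ℂ → HA L e dV hdV dW hdW → ℂ)
    (fT : ℂ → UnitaryGroup.arch (Fp L) L (IsCMField.complexConj L) (2 + 2) (hermD L e dV hdV dW hdW) ×
      (Π v : T', UnitaryGroup.localPi L (IsCMField.complexConj L) (2 + 2) (hermD L e dV hdV dW hdW) v.1) → ℂ)
    (hfac : IsFactorizableOff L e dV hdV dW hdW T' χ f fT) (s : ℂ) (h : HA L e dV hdV dW hdW)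
    (g₂ : (quasiSplit (Fp L) L (IsCMField.complexConj L) 2).Adelic) (y : AdeleRing (𝓞 L) L) (hy : conjAdele (Fp L) L (IsCMField.complexConj L) y = -y) (t : AdeleRing (𝓞 L) L) :
    f s (Ψ (jAdelic L 4 (weylXi (AdeleRing (𝓞 L) L) (conjAdele (Fp L) L (IsCMField.complexConj L)))) *
          Ψ (jAdelic L 4 (nKlingen (AdeleRing (𝓞 L) L) (conjAdele (Fp L) L (IsCMField.complexConj L)) (conjAdele_conjAdele' L) y hy 0 t)) *
          (Ψ (jAdelic L 4 (klingenLevi (AdeleRing (𝓞 L) L) (conjAdele (Fp L) L (IsCMField.complexConj L)) (conjAdele_conjAdele' L) 1 ((jAdelic L 2).symm g₂))) * h)) =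
      fT s (UnitaryGroup.archPart (Fp L) L (IsCMField.complexConj L) (2 + 2) (hermD L e dV hdV dW hdW)
              (Ψ (jAdelic L 4 (weylXi (AdeleRing (𝓞 L) L) (conjAdele (Fp L) L (IsCMField.complexConj L)))) *
                Ψ (jAdelic L 4 (nKlingen (AdeleRing (𝓞 L) L) (conjAdele (Fp L) L (IsCMField.complexConj L)) (conjAdele_conjAdele' L) y hy 0 t)) *
                (Ψ (jAdelic L 4 (klingenLevi (AdeleRing (𝓞 L) L) (conjAdele (Fp L) L (IsCMField.complexConj L)) (conjAdele_conjAdele' L) 1 ((jAdelic L 2).symm g₂))) * h)),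
            fun v : T' => UnitaryGroup.evalPlace (Fp L) L (IsCMField.complexConj L) (2 + 2) (hermD L e dV hdV dW hdW) v.1
              (UnitaryGroup.finPart (Fp L) L (IsCMField.complexConj L) (2 + 2) (hermD L e dV hdV dW hdW)
                (Ψ (jAdelic L 4 (weylXi (AdeleRing (𝓞 L) L) (conjAdele (Fp L) L (IsCMField.complexConj L)))) *
                  Ψ (jAdelic L 4 (nKlingen (AdeleRing (𝓞 L) L) (conjAdele (Fp L) L (IsCMField.complexConj L)) (conjAdele_conjAdele' L) y hy 0 t)) *
                  (Ψ (jAdelic L 4 (klingenLevi (AdeleRing (𝓞 L) L) (conjAdele (Fp L) L (IsCMField.complexConj L)) (conjAdele_conjAdele' L) 1 ((jAdelic L 2).symm g₂))) * h)))) *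
        ∏ᶠ v : {v : HeightOneSpectrum (𝓞 (Fp L)) // v ∉ T'},
          LambdaLoc L e dV hdV dW hdW v.1 χ s
            (psiLoc L Ψ.toMulEquiv.toMonoidHom v.1
                (weylXiLoc L v.1 * nKlingenLoc L v.1 (adeleToLocal L v.1 y) ((mem_skewLoc_iff L v.1 _).1 (adeleToLocal_mem_skewLoc L v.1 hy)) (adeleToLocal L v.1 0) (adeleToLocal L v.1 t) *
                  klingenLeviLoc L v.1 1 (UnitaryGroup.evalPlace (Fp L) L (IsCMField.complexConj L) 2 ((StdForm.antidiagonal 2).over L) v.1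
                    (UnitaryGroup.finPart (Fp L) L (IsCMField.complexConj L) 2 ((StdForm.antidiagonal 2).over L) g₂))) *
              UnitaryGroup.evalPlace (Fp L) L (IsCMField.complexConj L) (2 + 2) (hermD L e dV hdV dW hdW) v.1
                (UnitaryGroup.finPart (Fp L) L (IsCMField.complexConj L) (2 + 2) (hermD L e dV hdV dW hdW) h)) := by
  rw [hfac s]
  congr 1
  refine finprod_congr fun v => ?_
  rw [← evalPlace_finPart_letters L Ψ.toMulEquiv.toMonoidHom SA (fun g => hΨ g) v.1 y hy t g₂ h]
  rfl

end Shape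

/-- **the local factor is `1` at a good place where everything is integral**: if `χ` is unramified above `v`, `Ψ_v(U(J₄)(𝒪_v)) ≤ K_{H,v}` (`hΨK`), `h_v ∈ K_{H,v}`,
`(g₂)_v ∈ U(J₂)(𝒪_v)` and `y, t` are integral above `v`, then `Λ_{s,v}(Ψ_v(ξ_v n_{Q,v}(y,0,t) m_{Q,v}(1,(g₂)_v)) h_v) = 1` (★ `lambdaLoc_of_mem_localInt`, §2, ★
`klingenLeviLoc_one_mem_localInt`) — Tate's normalisation of the local factor OFF the finite exceptional set `{v ∉ T′ : (g₂)_v ∉ U(J₂)(𝒪_v)}` of ★ FILE D part 2.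
[cite: Li1992, §3] [cite: CasselsFrohlichANT1967, Ch. XV (Tate) §3.3] -/
theorem local_factor_eq_one {N M n : ℕ} (e : Fin N × Fin M ≃ Fin n) (dV : Fin N → L) (hdV : ∀ i, IsCMField.complexConj L (dV i) = dV i)
    (dW : Fin M → L) (hdW : ∀ i, IsCMField.complexConj L (dW i) = dW i) (v : HeightOneSpectrum (𝓞 (Fp L)))
    (Ψv : UnitaryGroup.localPi L (IsCMField.complexConj L) 4 ((StdForm.antidiagonal 4).over L) v →*
      UnitaryGroup.localPi L (IsCMField.complexConj L) (n + n) (hermD L e dV hdV dW hdW) v)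
    (hΨK : ∀ k ∈ UnitaryGroup.localInt L (IsCMField.complexConj L) 4 ((StdForm.antidiagonal 4).over L) v,
      Ψv k ∈ UnitaryGroup.localInt L (IsCMField.complexConj L) (n + n) (hermD L e dV hdV dW hdW) v)
    (χ : HeckeCharacter L) (s : ℂ) (hχ : ∀ w : UnitaryGroup.PlacesOver L v, χ.IsUnramifiedAt w.1)
    {hv : UnitaryGroup.localPi L (IsCMField.complexConj L) (n + n) (hermD L e dV hdV dW hdW) v}
    (hh : hv ∈ UnitaryGroup.localInt L (IsCMField.complexConj L) (n + n) (hermD L e dV hdV dW hdW) v)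
    {gv : UnitaryGroup.localPi L (IsCMField.complexConj L) 2 ((StdForm.antidiagonal 2).over L) v}
    (hg : gv ∈ UnitaryGroup.localInt L (IsCMField.complexConj L) 2 ((StdForm.antidiagonal 2).over L) v)
    {y : LocalRing L v} (hys : conjLocal L (IsCMField.complexConj L) v y = -y) {t : LocalRing L v}
    (hy : ∀ w : UnitaryGroup.PlacesOver L v, y w ∈ (ValuativeRel.valuation (w.1.adicCompletion L)).integer)
    (ht : ∀ w : UnitaryGroup.PlacesOver L v, t w ∈ (ValuativeRel.valuation (w.1.adicCompletion L)).integer) :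
    LambdaLoc L e dV hdV dW hdW v χ s (Ψv (weylXiLoc L v * nKlingenLoc L v y hys 0 t * klingenLeviLoc L v 1 gv) * hv) = 1 :=
  lambdaLoc_of_mem_localInt L e dV hdV dW hdW v χ s hχ
    (mul_mem (hΨK _ (mul_mem (mul_mem (weylXiLoc_mem_localInt L v) (nKlingenLoc_mem_localInt L v hys hy ht))
      (K2LiuKlingenInnerSectionLocalInvariance.klingenLeviLoc_one_mem_localInt L v hg))) hh)

end Summit.HodgeConjecture.HodgeConjecture.Cruxes.HLiu418.K2LiuKlingenInnerSectionShape

end
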